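import Summits.ResolutionOfSingularities.KangarooAtlas.MizutaniBoxDerivation
import Mathlib.RingTheory.MvPolynomial.WeightedHomogeneous
import HarnessLib

/-!
# Weighted filtrations of `K[u]/(u_i^q)`, initial forms, and the kernel bound by the leading operator

Cell topic `Summits/ResolutionOfSingularities/KangarooAtlas` (pub-rosobs); namespace
`Summit.ResolutionOfSingularities.KangarooAtlas.Mizutani`.  Part of the Lean transcription of Mizutani 1973 §2
around the in-house note MIZUTANI-PROOF-g59 (AI-written, AI-audited; *AI review is weaker than expert review*; not a
resolution theorem).  Linear algebra used for the equality case of Mizutani's Lemma 2.9 after base change to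
`K ⊗_L K ≅ K[u]/(u^q)`: for a weight vector `ω` on the variables,

* `wdegIdeal ω m` — the ideal of classes whose box representative only has monomials of `ω`-weight `≥ m`
  (multiplicative filtration; monomials, derivatives: `boxDeriv_mem_wdegIdeal` — `∂/∂u_i` lowers weights by `ω i`);
* `whomog ω m` — the submodule of classes all of whose monomials have weight `m`; `wComp ω m z` — the weight-`m`
  component; `exists_wComp_ne_zero` (the INITIAL FORM of `z ≠ 0`);
* **`eq_zero_of_initialForm`** — if `Ψ = Q₀ + R` with `Q₀` weighted-homogeneous of degree `−d` and `R` raising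
  weights by `> −d`, then an element of `ker Ψ` whose chosen coefficients vanish is `0` as soon as the same holds for
  `ker Q₀` (pass to the initial form); **`finrank_ker_le_card_of_initialForm`** — hence `dim_K ker Ψ ≤ #` chosen
  coefficients.

References: [Mizutani1973HironakaGroupSchemes] Lemma 2.9 (2) (proof outline, p. 94); folklore (initial forms).
-/

open MvPolynomial Literature.AlgebraicGeometry.Resolution

namespace Summit.ResolutionOfSingularities.KangarooAtlas.Mizutani

section Weight

variable {K : Type*} [Field K] {s q : ℕ} (ω : Fin s → ℕ)

/-! ### Box representatives determine classes -/

omit ω in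
/-- A class with vanishing box representative is zero. [folklore] -/
theorem eq_zero_of_truncQ_eq_zero {z : BoxQuot (Fin s) K q} (hz : truncQ (Fin s) K q z = 0) : z = 0 := by
  rw [← mk_truncQ z, hz, map_zero]

omit ω in
/-- Coefficients outside the box vanish. [folklore] -/
theorem coeff_truncQ_eq_zero_of_not_inBox (z : BoxQuot (Fin s) K q) {M : Fin s →₀ ℕ} (hM : ¬ InBox q M) :
    coeff M (truncQ (Fin s) K q z) = 0 := by
  by_contra hne
  exact hM (inBox_of_mem_support_truncQ z (mem_support_iff.mpr hne))

/-! ### The weighted degree ideals -/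

/-- Monomials of a truncated product: weights add. [folklore] -/
theorem weight_le_of_mem_support_trunc_mul {m m' : ℕ} {f g : MvPolynomial (Fin s) K}
    (hf : ∀ M ∈ f.support, m ≤ Finsupp.weight ω M) (hg : ∀ M ∈ g.support, m' ≤ Finsupp.weight ω M)
    {M : Fin s →₀ ℕ} (hM : M ∈ (trunc q (f * g)).support) : m + m' ≤ Finsupp.weight ω M := by
  classical
  have hM' : M ∈ (f * g).support := by
    rw [mem_support_iff] at hM ⊢
    rw [coeff_trunc] at hM
    split_ifs at hM with h
    · exact hM
    · exact absurd rfl hM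
  obtain ⟨M₁, hM₁, M₂, hM₂, rfl⟩ := Finset.mem_add.mp (support_mul f g hM')
  rw [map_add]
  exact Nat.add_le_add (hf M₁ hM₁) (hg M₂ hM₂)

variable (K s q) in
/-- **The weighted degree ideal** `wdegIdeal ω m ⊂ K[u]/(u^q)`: classes whose box representative only involves monomials of
`ω`-weight `≥ m`. [folklore] -/
noncomputable def wdegIdeal (m : ℕ) : Ideal (BoxQuot (Fin s) K q) where
  carrier := {z | ∀ M ∈ (truncQ (Fin s) K q z).support, m ≤ Finsupp.weight ω M}
  zero_mem' := by
    intro M hM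
    rw [map_zero, support_zero] at hM
    exact absurd hM (Finset.notMem_empty M)
  add_mem' := by
    intro z z' hz hz' M hM
    classical
    rw [map_add] at hM
    rcases Finset.mem_union.mp (support_add hM) with h | h
    · exact hz M h
    · exact hz' M h
  smul_mem' := by
    intro c z hz M hM
    rw [smul_eq_mul, truncQ_mul] at hM
    have := weight_le_of_mem_support_trunc_mul ω (m := 0) (m' := m) (fun _ _ => Nat.zero_le _) hz hM
    simpa using this

/-- Membership in the weighted degree ideal. [folklore] -/
theorem mem_wdegIdeal_iff {m : ℕ} {z : BoxQuot (Fin s) K q} :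
    z ∈ wdegIdeal K s q ω m ↔ ∀ M ∈ (truncQ (Fin s) K q z).support, m ≤ Finsupp.weight ω M := Iff.rfl

/-- Membership via coefficients: all monomials of weight `< m` have zero coefficient. [folklore] -/
theorem mem_wdegIdeal_iff_coeff {m : ℕ} {z : BoxQuot (Fin s) K q} :
    z ∈ wdegIdeal K s q ω m ↔ ∀ M, Finsupp.weight ω M < m → coeff M (truncQ (Fin s) K q z) = 0 := by
  rw [mem_wdegIdeal_iff]
  constructor
  · intro h M hM
    by_contra hne
    exact absurd (h M (mem_support_iff.mpr hne)) (not_le.mpr hM)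
  · intro h M hM
    by_contra hlt
    exact (mem_support_iff.mp hM) (h M (not_le.mp hlt))

/-- The filtration is decreasing. [folklore] -/
theorem wdegIdeal_anti {m m' : ℕ} (hmm' : m ≤ m') : wdegIdeal K s q ω m' ≤ wdegIdeal K s q ω m :=
  fun _ hz M hM => le_trans hmm' (hz M hM)

/-- `wdegIdeal ω 0 = ⊤`. [folklore] -/
theorem mem_wdegIdeal_zero (z : BoxQuot (Fin s) K q) : z ∈ wdegIdeal K s q ω 0 := fun _ _ => Nat.zero_le _

/-- The filtration is multiplicative. [folklore] -/
theorem mul_mem_wdegIdeal {m m' : ℕ} {z z' : BoxQuot (Fin s) K q} (hz : z ∈ wdegIdeal K s q ω m)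
    (hz' : z' ∈ wdegIdeal K s q ω m') : z * z' ∈ wdegIdeal K s q ω (m + m') := by
  intro M hM
  rw [truncQ_mul] at hM
  exact weight_le_of_mem_support_trunc_mul ω hz hz' hM

/-- A polynomial whose monomials all have weight `≥ m` defines a class in `wdegIdeal ω m`. [folklore] -/
theorem mk_mem_wdegIdeal {m : ℕ} {f : MvPolynomial (Fin s) K} (hf : ∀ M ∈ f.support, m ≤ Finsupp.weight ω M) :
    Ideal.Quotient.mk (boxIdeal (Fin s) K q) f ∈ wdegIdeal K s q ω m := by
  intro M hM
  rw [truncQ_mk, mem_support_iff, coeff_trunc] at hM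
  split_ifs at hM with h
  · exact hf M (mem_support_iff.mpr hM)
  · exact absurd rfl hM

/-- `[monomial M c] ∈ wdegIdeal ω (weight M)`. [folklore] -/
theorem mk_monomial_mem_wdegIdeal (M : Fin s →₀ ℕ) (c : K) :
    Ideal.Quotient.mk (boxIdeal (Fin s) K q) (monomial M c) ∈ wdegIdeal K s q ω (Finsupp.weight ω M) := by
  classical
  refine mk_mem_wdegIdeal ω fun M' hM' => ?_
  rw [support_monomial] at hM'
  split_ifs at hM' with hc
  · exact absurd hM' (Finset.notMem_empty _)
  · rw [Finset.mem_singleton.mp hM']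

/-- `[u_i] ∈ wdegIdeal ω (ω i)`. [folklore] -/
theorem mk_X_mem_wdegIdeal (i : Fin s) : Ideal.Quotient.mk (boxIdeal (Fin s) K q) (X i) ∈ wdegIdeal K s q ω (ω i) := by
  have := mk_monomial_mem_wdegIdeal (K := K) (q := q) ω (Finsupp.single i 1) 1
  rwa [Finsupp.weight_single, one_smul, ← X_pow_eq_monomial, pow_one] at this

/-! ### Homogeneous elements and components -/

variable (K s q) in
/-- **The weight-`m` homogeneous classes**: the `K`-submodule of classes every monomial of whose box representative has
`ω`-weight `m`. [folklore] -/
noncomputable def whomog (m : ℕ) : Submodule K (BoxQuot (Fin s) K q) where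
  carrier := {z | ∀ M ∈ (truncQ (Fin s) K q z).support, Finsupp.weight ω M = m}
  zero_mem' := by
    intro M hM
    rw [map_zero, support_zero] at hM
    exact absurd hM (Finset.notMem_empty M)
  add_mem' := by
    intro z z' hz hz' M hM
    classical
    rw [map_add] at hM
    rcases Finset.mem_union.mp (support_add hM) with h | h
    · exact hz M h
    · exact hz' M h
  smul_mem' := by
    intro c z hz M hM
    rw [LinearMap.map_smul] at hM
    exact hz M (support_smul hM)

/-- Membership in `whomog`. [folklore] -/
theorem mem_whomog_iff {m : ℕ} {z : BoxQuot (Fin s) K q} :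
    z ∈ whomog K s q ω m ↔ ∀ M ∈ (truncQ (Fin s) K q z).support, Finsupp.weight ω M = m := Iff.rfl

/-- Constant multiples of homogeneous elements. [folklore] -/
theorem C_mul_mem_whomog {m : ℕ} {z : BoxQuot (Fin s) K q} (hz : z ∈ whomog K s q ω m) (c : K) :
    Ideal.Quotient.mk _ (C c) * z ∈ whomog K s q ω m := by
  intro M hM
  rw [truncQ_C_mul, C_mul'] at hM
  exact hz M (support_smul hM)

/-- A homogeneous element of weight `m` lies in `wdegIdeal ω m`. [folklore] -/
theorem mem_wdegIdeal_of_mem_whomog {m : ℕ} {z : BoxQuot (Fin s) K q} (hz : z ∈ whomog K s q ω m) :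
    z ∈ wdegIdeal K s q ω m :=
  fun M hM => (hz M hM).ge

/-- **A homogeneous element of weight `m` lying in `wdegIdeal ω (m + 1)` vanishes.** [folklore] -/
theorem eq_zero_of_mem_whomog_of_mem {m : ℕ} {z : BoxQuot (Fin s) K q} (hz : z ∈ whomog K s q ω m)
    (hz' : z ∈ wdegIdeal K s q ω (m + 1)) : z = 0 := by
  apply eq_zero_of_truncQ_eq_zero
  by_contra hne
  obtain ⟨M, hM⟩ := Finset.nonempty_iff_ne_empty.mpr fun h => hne (support_eq_empty.mp h)
  have h1 := hz M hM
  have h2 := hz' M hM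
  omega

variable (K s q) in
/-- **The weight-`m` component** of a class (through its box representative). [folklore] -/
noncomputable def wComp (m : ℕ) (z : BoxQuot (Fin s) K q) : BoxQuot (Fin s) K q :=
  Ideal.Quotient.mk _ (weightedHomogeneousComponent ω m (truncQ (Fin s) K q z))

/-- The box representative of the component is the component of the box representative. [folklore] -/
theorem truncQ_wComp (m : ℕ) (z : BoxQuot (Fin s) K q) :
    truncQ (Fin s) K q (wComp K s q ω m z) = weightedHomogeneousComponent ω m (truncQ (Fin s) K q z) := by
  classical
  unfold wComp
  rw [truncQ_mk]
  refine trunc_eq_self fun M hM => inBox_of_mem_support_truncQ z ?_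
  rw [mem_support_iff, coeff_weightedHomogeneousComponent] at hM
  rw [mem_support_iff]
  split_ifs at hM with h
  · exact hM
  · exact absurd rfl hM

/-- Coefficients of the component. [folklore] -/
theorem coeff_truncQ_wComp (m : ℕ) (z : BoxQuot (Fin s) K q) (M : Fin s →₀ ℕ) :
    coeff M (truncQ (Fin s) K q (wComp K s q ω m z)) =
      if Finsupp.weight ω M = m then coeff M (truncQ (Fin s) K q z) else 0 := by
  classical
  rw [truncQ_wComp, coeff_weightedHomogeneousComponent]

/-- The component is homogeneous. [folklore] -/
theorem wComp_mem_whomog (m : ℕ) (z : BoxQuot (Fin s) K q) : wComp K s q ω m z ∈ whomog K s q ω m := by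
  intro M hM
  rw [mem_support_iff, coeff_truncQ_wComp] at hM
  by_contra h
  exact hM (if_neg h)

/-- **Splitting off the initial form**: if all monomials of `z` have weight `≥ m`, then `z − wComp m z ∈ wdegIdeal ω (m+1)`.
[folklore] -/
theorem sub_wComp_mem_wdegIdeal {m : ℕ} {z : BoxQuot (Fin s) K q} (hz : z ∈ wdegIdeal K s q ω m) :
    z - wComp K s q ω m z ∈ wdegIdeal K s q ω (m + 1) := by
  rw [mem_wdegIdeal_iff_coeff]
  intro M hM
  rw [map_sub, coeff_sub, coeff_truncQ_wComp]
  split_ifs with h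
  · rw [sub_self]
  · rw [sub_zero]
    rw [mem_wdegIdeal_iff_coeff] at hz
    rcases Nat.lt_or_ge (Finsupp.weight ω M) m with hlt | hge
    · exact hz M hlt
    · exfalso; omega

/-- **Existence of the initial form**: a nonzero class has a least weight `m` with `z ∈ wdegIdeal ω m` and nonzero
weight-`m` component. [folklore] -/
theorem exists_wComp_ne_zero {z : BoxQuot (Fin s) K q} (hz : z ≠ 0) :
    ∃ m, z ∈ wdegIdeal K s q ω m ∧ wComp K s q ω m z ≠ 0 := by
  classical
  have hne : (truncQ (Fin s) K q z).support.Nonempty := by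
    rw [Finset.nonempty_iff_ne_empty]
    intro h
    exact hz (eq_zero_of_truncQ_eq_zero (support_eq_empty.mp h))
  obtain ⟨M₀, hM₀, hmin⟩ := Finset.exists_min_image _ (fun M => Finsupp.weight ω M) hne
  refine ⟨Finsupp.weight ω M₀, fun M hM => hmin M hM, fun h0 => ?_⟩
  have := congrArg (fun w => coeff M₀ (truncQ (Fin s) K q w)) h0
  simp only [coeff_truncQ_wComp, map_zero, coeff_zero] at this
  exact (mem_support_iff.mp hM₀) this

end Weight

/-! ### Derivatives and weights -/

section DerivWeight

variable {K : Type*} [Field K] {s p e : ℕ} [CharP K p] (ω : Fin s → ℕ)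

/-- Weight of `M + e_i`. [folklore] -/
theorem weight_add_single (M : Fin s →₀ ℕ) (i : Fin s) :
    Finsupp.weight ω (M + Finsupp.single i 1) = Finsupp.weight ω M + ω i := by
  rw [map_add, Finsupp.weight_single, one_smul]

/-- **`∂/∂u_i` lowers weights by `ω i`**: `wdegIdeal ω m → wdegIdeal ω (m − ω i)`. [folklore] -/
theorem boxDeriv_mem_wdegIdeal (he : 1 ≤ e) (i : Fin s) {m : ℕ} {z : BoxQuot (Fin s) K (p ^ e)}
    (hz : z ∈ wdegIdeal K s (p ^ e) ω m) : boxDeriv K s (p ^ e) i z ∈ wdegIdeal K s (p ^ e) ω (m - ω i) := by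
  rw [mem_wdegIdeal_iff_coeff] at hz ⊢
  intro M hM
  by_cases hbox : InBox (p ^ e) M
  · rw [coeff_truncQ_boxDeriv he i z M hbox, hz _ (by rw [weight_add_single]; omega), zero_mul]
  · exact coeff_truncQ_eq_zero_of_not_inBox _ hbox

/-- `∂/∂u_i` maps homogeneous elements of weight `m` to homogeneous elements of weight `m − ω i`. [folklore] -/
theorem boxDeriv_mem_whomog (he : 1 ≤ e) (i : Fin s) {m : ℕ} {z : BoxQuot (Fin s) K (p ^ e)}
    (hz : z ∈ whomog K s (p ^ e) ω m) : boxDeriv K s (p ^ e) i z ∈ whomog K s (p ^ e) ω (m - ω i) := by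
  intro M hM
  rw [mem_support_iff] at hM
  by_cases hbox : InBox (p ^ e) M
  · rw [coeff_truncQ_boxDeriv he i z M hbox] at hM
    have hM' : M + Finsupp.single i 1 ∈ (truncQ (Fin s) K (p ^ e) z).support := by
      rw [mem_support_iff]; intro h0; exact hM (by rw [h0, zero_mul])
    have := hz _ hM'
    rw [weight_add_single] at this
    omega
  · exact absurd (coeff_truncQ_eq_zero_of_not_inBox _ hbox) hM

/-- `∂/∂u_i` kills homogeneous elements of weight `< ω i`. [folklore] -/
theorem boxDeriv_eq_zero_of_mem_whomog (he : 1 ≤ e) (i : Fin s) {m : ℕ} {z : BoxQuot (Fin s) K (p ^ e)}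
    (hz : z ∈ whomog K s (p ^ e) ω m) (hm : m < ω i) : boxDeriv K s (p ^ e) i z = 0 := by
  apply eq_zero_of_truncQ_eq_zero
  refine MvPolynomial.ext _ _ fun M => ?_
  rw [coeff_zero]
  by_cases hbox : InBox (p ^ e) M
  · rw [coeff_truncQ_boxDeriv he i z M hbox]
    by_cases hM' : M + Finsupp.single i 1 ∈ (truncQ (Fin s) K (p ^ e) z).support
    · have := hz _ hM'
      rw [weight_add_single] at this
      omega
    · rw [notMem_support_iff.mp hM', zero_mul]
  · exact coeff_truncQ_eq_zero_of_not_inBox _ hbox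

/-- Multiplication by a constant `[C c]` preserves the weighted degree ideals. [folklore] -/
theorem C_mul_mem_wdegIdeal {q m : ℕ} (c : K) {z : BoxQuot (Fin s) K q} (hz : z ∈ wdegIdeal K s q ω m) :
    Ideal.Quotient.mk _ (C c) * z ∈ wdegIdeal K s q ω m :=
  Ideal.mul_mem_left _ _ hz

end DerivWeight

/-! ### The initial-form argument -/

section InitialForm

variable {K : Type*} [Field K] {s q : ℕ} (ω : Fin s → ℕ)

/-- **Initial forms.**  Let `Ψ, Q₀ : K[u]/(u^q) → K[u]/(u^q)` be `K`-linear with `Q₀` homogeneous of degree `−d`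
(it maps weight-`m` homogeneous elements to weight-`(m − d)` homogeneous ones, kills those of weight `< d`, and respects
the filtration) and `R = Ψ − Q₀` raising the filtration by more (`wdegIdeal m → wdegIdeal (m − d + 1)`).  If every
`g ∈ ker Q₀` whose coefficients at the indices `𝓜` vanish is `0`, then so is every `z ∈ ker Ψ` with the same vanishing:
its initial form `g` (least-weight component) satisfies `Q₀ g = 0`. [folklore] -/
theorem eq_zero_of_initialForm {Ψ Q₀ : BoxQuot (Fin s) K q →ₗ[K] BoxQuot (Fin s) K q} {d : ℕ}
    (hQhom : ∀ m z, z ∈ whomog K s q ω m → d ≤ m → Q₀ z ∈ whomog K s q ω (m - d))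
    (hQlow : ∀ m z, z ∈ whomog K s q ω m → m < d → Q₀ z = 0)
    (hQord : ∀ m z, z ∈ wdegIdeal K s q ω m → Q₀ z ∈ wdegIdeal K s q ω (m - d))
    (hR : ∀ m z, z ∈ wdegIdeal K s q ω m → (Ψ - Q₀) z ∈ wdegIdeal K s q ω (m - d + 1))
    {𝓜 : Set (Fin s →₀ ℕ)}
    (hc : ∀ g, Q₀ g = 0 → (∀ M ∈ 𝓜, coeff M (truncQ (Fin s) K q g) = 0) → g = 0)
    {z : BoxQuot (Fin s) K q} (hz : Ψ z = 0) (hcoef : ∀ M ∈ 𝓜, coeff M (truncQ (Fin s) K q z) = 0) : z = 0 := by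
  by_contra hne
  obtain ⟨m₀, hzm, hg⟩ := exists_wComp_ne_zero ω hne
  set g := wComp K s q ω m₀ z with hgdef
  have hghom : g ∈ whomog K s q ω m₀ := wComp_mem_whomog ω m₀ z
  have hr : z - g ∈ wdegIdeal K s q ω (m₀ + 1) := sub_wComp_mem_wdegIdeal ω hzm
  -- `Q₀ z = −R z` is deep in the filtration
  have hQz : Q₀ z ∈ wdegIdeal K s q ω (m₀ - d + 1) := by
    have h1 := hR m₀ z hzm
    rw [LinearMap.sub_apply, hz, zero_sub] at h1
    simpa using (wdegIdeal K s q ω (m₀ - d + 1)).neg_mem h1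
  -- hence `Q₀ g = 0`
  have hQg : Q₀ g = 0 := by
    rcases Nat.lt_or_ge m₀ d with hlt | hge
    · exact hQlow m₀ g hghom hlt
    · have hQr : Q₀ (z - g) ∈ wdegIdeal K s q ω (m₀ - d + 1) := by
        have := hQord (m₀ + 1) (z - g) hr
        have heq : m₀ + 1 - d = m₀ - d + 1 := by omega
        rwa [heq] at this
      have hQg' : Q₀ g ∈ wdegIdeal K s q ω (m₀ - d + 1) := by
        have : Q₀ g = Q₀ z - Q₀ (z - g) := by rw [map_sub, sub_sub_cancel]
        rw [this]
        exact Submodule.sub_mem _ hQz hQr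
      exact eq_zero_of_mem_whomog_of_mem ω (hQhom m₀ g hghom hge) hQg'
  -- and the chosen coefficients of `g` vanish
  have hgcoef : ∀ M ∈ 𝓜, coeff M (truncQ (Fin s) K q g) = 0 := by
    intro M hM
    rw [hgdef, coeff_truncQ_wComp]
    split_ifs
    · exact hcoef M hM
    · rfl
  exact hg (hc g hQg hgcoef)

/-- The coordinate map at a finite set of indices. [folklore] -/
noncomputable def coordMap (K : Type*) [Field K] (s q : ℕ) (𝓜 : Finset (Fin s →₀ ℕ)) :
    BoxQuot (Fin s) K q →ₗ[K] (𝓜 → K) where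
  toFun z M := coeff (M : Fin s →₀ ℕ) (truncQ (Fin s) K q z)
  map_add' z z' := by funext M; simp only [map_add, coeff_add, Pi.add_apply]
  map_smul' c z := by funext M; simp only [LinearMap.map_smul, coeff_smul, Pi.smul_apply, RingHom.id_apply]

/-- **Kernel bound by initial forms**: under the hypotheses of `eq_zero_of_initialForm` with a finite index set `𝓜`,
`dim_K ker Ψ ≤ #𝓜`. [folklore] -/
theorem finrank_ker_le_card_of_initialForm {Ψ Q₀ : BoxQuot (Fin s) K q →ₗ[K] BoxQuot (Fin s) K q} {d : ℕ}
    (hQhom : ∀ m z, z ∈ whomog K s q ω m → d ≤ m → Q₀ z ∈ whomog K s q ω (m - d))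
    (hQlow : ∀ m z, z ∈ whomog K s q ω m → m < d → Q₀ z = 0)
    (hQord : ∀ m z, z ∈ wdegIdeal K s q ω m → Q₀ z ∈ wdegIdeal K s q ω (m - d))
    (hR : ∀ m z, z ∈ wdegIdeal K s q ω m → (Ψ - Q₀) z ∈ wdegIdeal K s q ω (m - d + 1))
    (𝓜 : Finset (Fin s →₀ ℕ))
    (hc : ∀ g, Q₀ g = 0 → (∀ M ∈ 𝓜, coeff M (truncQ (Fin s) K q g) = 0) → g = 0) :
    Module.finrank K (LinearMap.ker Ψ) ≤ 𝓜.card := by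
  set lam : LinearMap.ker Ψ →ₗ[K] (𝓜 → K) := (coordMap K s q 𝓜) ∘ₗ (LinearMap.ker Ψ).subtype with hlam
  have hinj : Function.Injective lam := by
    rw [injective_iff_map_eq_zero]
    intro z hz0
    have hcoef : ∀ M ∈ (𝓜 : Set (Fin s →₀ ℕ)), coeff M (truncQ (Fin s) K q (z : BoxQuot (Fin s) K q)) = 0 := by
      intro M hM
      have := congrFun hz0 ⟨M, Finset.mem_coe.mp hM⟩
      exact this
    have := eq_zero_of_initialForm ω hQhom hQlow hQord hR (𝓜 := (𝓜 : Set (Fin s →₀ ℕ)))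
      (fun g hg hgc => hc g hg fun M hM => hgc M (Finset.mem_coe.mpr hM)) (LinearMap.mem_ker.mp z.2) hcoef
    exact Subtype.ext this
  have h1 := LinearMap.finrank_le_finrank_of_injective hinj
  rwa [Module.finrank_fintype_fun_eq_card, Fintype.card_coe] at h1

end InitialForm

end Summit.ResolutionOfSingularities.KangarooAtlas.Mizutani
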